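import Summits.ValiantsHypothesis.ValiantsHypothesis.Theorems.DepthWindowMassProfile

/-!
# Route `DepthWindow` — conservation of cancellation in a layered tree

Cone-free helper (decomp-valiant lens 4, g15; critic 675 NEXT (d)) supporting the crux item `HomImmHardTwoOne`
(stmt-ValiantsHypothesis-30635).  For a node `v` of a `w`-tree let `cancel(v) := Σ_{children c} |Sum(c)| − |Sum(v)|`
(`≥ 0`; `= Nodebias(v) − |Sum(v)|`).  Summed over the nodes of one level it is the drop of the level mass
(`sum_cancel_level`), so over the whole tree it TELESCOPES:

  `Σ_{levels ℓ < Δ} Σ_{nodes v at level ℓ+1} cancel(v) = ‖w‖₁ − |Σ w|`   (`sum_cancel_eq`, single-block root).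

Every tree for `w` must perform the same total cancellation `‖w‖₁ − |Σ w|`; depth lower bounds are statements about
how UNEVENLY a given word forces it to be spent (few nodes ⇒ some node cancels a lot ⇒ large node bias), upper
bounds (`DepthWindowTwoLetterULB`, `DepthWindowBoundedLetters`) spend it at `≤ 6h` per node.  Also:
`blockSum_succ_eq_sum_children` (a block's sum is the sum of its children's sums), `levelMass_root`.

References: [LimayeSrinivasanTavenas2022] full version ECCC TR22-090 Def. 2, Def. 15, Prop. 17.
-/

-- layout Summits/ValiantsHypothesis/ValiantsHypothesis forces the duplicated namespace component
set_option linter.dupNamespace false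

namespace Summit.ValiantsHypothesis.ValiantsHypothesis.Theorems.DepthWindow.TreeBias

open Finset

variable {d : ℕ}

/-- The labels of the children of the level-`(ℓ+1)` block labelled `L`: the level-`ℓ` blocks inside it.
[cite: LimayeSrinivasanTavenas2022, Def. 2] -/
def children (T : LTree d) (ℓ : ℕ) (L : Fin d) : Finset (Fin d) :=
  (univ.filter fun j => T.lab (ℓ + 1) j = L).image (T.lab ℓ)

/-- A letter of a child block lies in the parent block. [folklore] -/
theorem lab_succ_eq_of_mem_children (T : LTree d) (ℓ : ℕ) (L : Fin d) {l : Fin d} (hl : l ∈ children T ℓ L)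
    {j : Fin d} (hj : T.lab ℓ j = l) : T.lab (ℓ + 1) j = L := by
  obtain ⟨j₀, hj₀, rfl⟩ := mem_image.1 hl
  rw [← (mem_filter.1 hj₀).2]
  exact T.refine ℓ j j₀ hj

/-- **A block's sum is the sum of its children's sums.** [cite: LimayeSrinivasanTavenas2022, Def. 2] -/
theorem blockSum_succ_eq_sum_children (w : Fin d → ℤ) (T : LTree d) (ℓ : ℕ) (L : Fin d) :
    blockSum w T (ℓ + 1) L = ∑ l ∈ children T ℓ L, blockSum w T ℓ l := by
  classical
  unfold blockSum children
  rw [← sum_fiberwise_of_maps_to (s := univ.filter fun j => T.lab (ℓ + 1) j = L)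
    (t := (univ.filter fun j => T.lab (ℓ + 1) j = L).image (T.lab ℓ)) (g := T.lab ℓ)
    (fun j hj => mem_image_of_mem _ hj)]
  refine sum_congr rfl fun l hl => sum_congr ?_ fun _ _ => rfl
  ext j
  simp only [mem_filter, mem_univ, true_and, and_iff_right_iff_imp]
  intro hj
  exact lab_succ_eq_of_mem_children T ℓ L (by unfold children; exact hl) hj

/-- The level mass, grouped by parent blocks. [folklore] -/
theorem levelMass_eq_sum_parent (w : Fin d → ℤ) (T : LTree d) (ℓ : ℕ) :
    levelMass w T ℓ = ∑ L ∈ univ.image (T.lab (ℓ + 1)), ∑ l ∈ children T ℓ L, |blockSum w T ℓ l| := by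
  classical
  unfold levelMass
  have hcover : univ.image (T.lab ℓ) = (univ.image (T.lab (ℓ + 1))).biUnion (children T ℓ) := by
    ext l
    simp only [mem_image, mem_univ, true_and, mem_biUnion, children, mem_filter]
    constructor
    · rintro ⟨j, rfl⟩; exact ⟨T.lab (ℓ + 1) j, ⟨j, rfl⟩, j, rfl, rfl⟩
    · rintro ⟨L, -, j, -, rfl⟩; exact ⟨j, rfl⟩
  have hdisj : (↑(univ.image (T.lab (ℓ + 1))) : Set (Fin d)).PairwiseDisjoint (children T ℓ) := by
    intro L _ L' _ hne
    rw [Function.onFun, disjoint_left]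
    intro l hl hl'
    obtain ⟨j, -, hj⟩ := mem_image.1 hl
    exact hne ((lab_succ_eq_of_mem_children T ℓ L hl hj).symm.trans (lab_succ_eq_of_mem_children T ℓ L' hl' hj))
  rw [hcover, sum_biUnion hdisj]

/-- The **cancellation** at the level-`(ℓ+1)` block labelled `L`: `Σ_{children} |Sum| − |Sum|`.
[cite: LimayeSrinivasanTavenas2022, Def. 15] -/
def cancel (w : Fin d → ℤ) (T : LTree d) (ℓ : ℕ) (L : Fin d) : ℤ :=
  (∑ l ∈ children T ℓ L, |blockSum w T ℓ l|) - |blockSum w T (ℓ + 1) L|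

/-- Cancellation is nonnegative (triangle inequality). [folklore] -/
theorem cancel_nonneg (w : Fin d → ℤ) (T : LTree d) (ℓ : ℕ) (L : Fin d) : 0 ≤ cancel w T ℓ L := by
  unfold cancel
  rw [blockSum_succ_eq_sum_children]
  linarith [abs_sum_le_sum_abs (fun l => blockSum w T ℓ l) (children T ℓ L)]

/-- `cancel = Nodebias − |Sum|` at every node. [cite: LimayeSrinivasanTavenas2022, Def. 15] -/
theorem cancel_eq_nodeBias_sub (w : Fin d → ℤ) (T : LTree d) (ℓ : ℕ) (i : Fin d) :
    cancel w T ℓ (T.lab (ℓ + 1) i) = nodeBias w T (ℓ + 1) i - |blockSum w T (ℓ + 1) (T.lab (ℓ + 1) i)| := by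
  unfold cancel nodeBias children
  rfl

/-- Hence `Nodebias ≥ cancel`: a node that cancels a lot has large bias. [cite: LimayeSrinivasanTavenas2022, Def. 15] -/
theorem cancel_le_nodeBias (w : Fin d → ℤ) (T : LTree d) (ℓ : ℕ) (i : Fin d) :
    cancel w T ℓ (T.lab (ℓ + 1) i) ≤ nodeBias w T (ℓ + 1) i := by
  rw [cancel_eq_nodeBias_sub]
  linarith [abs_nonneg (blockSum w T (ℓ + 1) (T.lab (ℓ + 1) i))]

/-- **Per level**: the cancellations of the level-`(ℓ+1)` nodes add up to the drop of the level mass. [folklore] -/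
theorem sum_cancel_level (w : Fin d → ℤ) (T : LTree d) (ℓ : ℕ) :
    ∑ L ∈ univ.image (T.lab (ℓ + 1)), cancel w T ℓ L = levelMass w T ℓ - levelMass w T (ℓ + 1) := by
  unfold cancel
  rw [sum_sub_distrib, levelMass_eq_sum_parent]
  rfl

/-- The mass of a single-block level is `|Σ w|`. [folklore] -/
theorem levelMass_root (w : Fin d → ℤ) (T : LTree d) {Δ : ℕ} (hroot : ∀ i j, T.lab Δ i = T.lab Δ j) :
    levelMass w T Δ = |∑ j, w j| := by
  classical
  unfold levelMass
  rcases Nat.eq_zero_or_pos d with rfl | hd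
  · simp
  · have himg : univ.image (T.lab Δ) = {T.lab Δ ⟨0, hd⟩} := by
      ext L
      simp only [mem_image, mem_univ, true_and, mem_singleton]
      exact ⟨fun ⟨j, hj⟩ => hj.symm.trans (hroot j _), fun h => ⟨⟨0, hd⟩, h.symm⟩⟩
    rw [himg, sum_singleton]
    unfold blockSum
    rw [filter_true_of_mem fun j _ => hroot j _]

/-- **Conservation of cancellation.**  In a tree with a single root block at level `Δ`, the total cancellation over
all nodes equals `‖w‖₁ − |Σ w|` — the same for EVERY tree of the word. [cite: LimayeSrinivasanTavenas2022, Prop. 17] -/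
theorem sum_cancel_eq (w : Fin d → ℤ) (T : LTree d) {Δ : ℕ} (hroot : ∀ i j, T.lab Δ i = T.lab Δ j) :
    ∑ ℓ ∈ range Δ, ∑ L ∈ univ.image (T.lab (ℓ + 1)), cancel w T ℓ L = (∑ j, |w j|) - |∑ j, w j| := by
  rw [sum_congr rfl fun ℓ _ => sum_cancel_level w T ℓ, sum_range_sub', levelMass_zero, levelMass_root w T hroot]

/-- **The budget reading.**  In a tree with node biases `≤ β` (levels `1 … Δ`), every node cancels `≤ β`, so the
word's forced total cancellation is spread over the nodes: `‖w‖₁ − |Σ w| ≤ β · #(nodes at levels 1 … Δ)`.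
[cite: LimayeSrinivasanTavenas2022, Prop. 17] -/
theorem norm_sub_abs_sum_le_of_nodeBias_le (w : Fin d → ℤ) (T : LTree d) {Δ : ℕ} {β : ℤ}
    (hroot : ∀ i j, T.lab Δ i = T.lab Δ j) (hnb : ∀ u, 1 ≤ u → u ≤ Δ → ∀ i, nodeBias w T u i ≤ β) :
    (∑ j, |w j|) - |∑ j, w j| ≤ β * ∑ ℓ ∈ range Δ, (levelCount T (ℓ + 1) : ℤ) := by
  rw [← sum_cancel_eq w T hroot, mul_sum]
  refine sum_le_sum fun ℓ hℓ => ?_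
  have hℓ' := mem_range.1 hℓ
  unfold levelCount
  calc ∑ L ∈ univ.image (T.lab (ℓ + 1)), cancel w T ℓ L ≤ ∑ L ∈ univ.image (T.lab (ℓ + 1)), β := by
        refine sum_le_sum fun L hL => ?_
        obtain ⟨i, -, rfl⟩ := mem_image.1 hL
        exact (cancel_le_nodeBias w T ℓ i).trans (hnb (ℓ + 1) (by omega) hℓ' i)
    _ = β * ((univ.image (T.lab (ℓ + 1))).card : ℤ) := by rw [sum_const, nsmul_eq_mul, mul_comm]
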